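import Literature.NumberTheory.CubicFields.MemUCriterion
import Mathlib.Data.ZMod.Basic
import Mathlib.Data.Nat.Prime.Int
import Mathlib.Tactic.LinearCombination
import HarnessLib

/-!
# A singular zero modulo `p` of a binary cubic form with `p ∣ Disc`: the root of the Hessian

Topic `Literature/NumberTheory/CubicFields`, continuing `MemUCriterion.lean` (`f ∈ U_p` iff `p ∤ f`
and `f` has no singular zero `(x, y)` with `p² ∣ f(x,y)`, `p ∣ f_u(x,y)`, `p ∣ f_v(x,y)`;
Davenport–Heilbronn 1971 §2, BTT 2023 Prop. 2.2).

Davenport–Heilbronn 1971, §2–3, analyse `U_p` through the factorisation of `f` modulo `p`: if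
`p ∣ D(f)` then `f (mod p)` has a multiple root, which may be moved to `(1 : 0)` by `GL₂(ℤ)`, i.e.
`p ∣ a`, `p ∣ b`. This file PROVES that step by explicit invariant theory (no root extraction):

* with `(P, Q, R) = (b² − 3ac, bc − 9ad, c² − 3bd)` the coefficients of the Hessian covariant
  (written out, no new definition): `Q² − 4PR = −3·Disc` (`hessQ_sq_sub`), the polynomial identities
  `f(−Q, 2P) = −(2b³ − 9abc + 27a²d)·Disc`, `f_u(−Q, 2P) = −9a·Disc`, `f_v(−Q, 2P) = −3b·Disc`,
  their mirror images at `(2R, −Q)`, and `f(−b, 3a) = 2abP − 3a²Q`, … : the root of the Hessian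
  (resp. the triple root) is a singular zero of `f` modulo any divisor of `Disc` (resp. of `P, Q, R`);
* `BinaryCubic.exists_singular_zero_mod` — **if `p` is prime, `p ∤ f` and `p ∣ Disc f`, then `f`
  has a singular zero modulo `p`**: a point `(r, s) ≢ (0, 0)` with `p ∣ f(r,s), f_u(r,s), f_v(r,s)`
  (for `p = 2, 3` by exhaustion over `𝔽_p`);
* `BinaryCubic.exists_isCoprime_congr` — a point `≢ (0,0) (mod p)` is congruent to a primitive one;
* **`BinaryCubic.exists_gl2zEquiv_dvd_a_dvd_b`** — hence some `GL₂(ℤ)`-translate `g` of `f` has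
  `p ∣ a(g)` and `p ∣ b(g)` (the multiple root at `(1 : 0)`).

All statements are proved. The valuation bounds for `f ∈ U_p` that follow (`p³ ∤ Disc` for
`p ≥ 5`, `2⁴ ∤ Disc`, `3⁶ ∤ Disc`) are in `MaximalDiscriminantValuation.lean`.

## References

* H. Davenport, H. Heilbronn, *On the density of discriminants of cubic fields. II*, Proc. Roy.
  Soc. London A 322 (1971) 405–420, §§2–3 [DavenportHeilbronn1971].
* M. Bhargava, T. Taniguchi, F. Thorne, *Improved error estimates for the Davenport–Heilbronn
  theorems*, Math. Ann. 389 (2024) = arXiv:2107.12819, Prop. 2.2 [BhargavaTaniguchiThorne2023].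
-/

namespace Literature.NumberTheory.CubicFields

namespace BinaryCubic

/-! ### The Hessian coefficients and the singular-point identities -/

section CommRing

variable {R : Type*} [CommRing R] (f : BinaryCubic R)

/-- `Disc(Hessian) = −3·Disc(f)`: `Q² − 4PR = −3 Disc`. [folklore] -/
theorem hessQ_sq_sub : (f.b * f.c - 9 * f.a * f.d) ^ 2 - 4 * (f.b ^ 2 - 3 * f.a * f.c) * (f.c ^ 2 - 3 * f.b * f.d) = -3 * f.disc := by
  simp only [disc_eq]; ring

/-- `f(−Q, 2P) = (−2b³ + 9abc − 27a²d) · Disc`. [folklore] -/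
theorem eval_neg_hessQ : f.eval (-(f.b * f.c - 9 * f.a * f.d)) (2 * (f.b ^ 2 - 3 * f.a * f.c)) =
    (-2 * f.b ^ 3 + 9 * f.a * f.b * f.c - 27 * f.a ^ 2 * f.d) * f.disc := by
  simp only [eval, disc_eq]; ring

/-- `f_u(−Q, 2P) = −9a · Disc`. [folklore] -/
theorem derivU_neg_hessQ : f.derivU (-(f.b * f.c - 9 * f.a * f.d)) (2 * (f.b ^ 2 - 3 * f.a * f.c)) = -9 * f.a * f.disc := by
  simp only [derivU, disc_eq]; ring

/-- `f_v(−Q, 2P) = −3b · Disc`. [folklore] -/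
theorem derivV_neg_hessQ : f.derivV (-(f.b * f.c - 9 * f.a * f.d)) (2 * (f.b ^ 2 - 3 * f.a * f.c)) = -3 * f.b * f.disc := by
  simp only [derivV, disc_eq]; ring

/-- `f(2R, −Q) = (−2c³ + 9bcd − 27ad²) · Disc`. [folklore] -/
theorem eval_two_hessR : f.eval (2 * (f.c ^ 2 - 3 * f.b * f.d)) (-(f.b * f.c - 9 * f.a * f.d)) =
    (-2 * f.c ^ 3 + 9 * f.b * f.c * f.d - 27 * f.a * f.d ^ 2) * f.disc := by
  simp only [eval, disc_eq]; ring

/-- `f_u(2R, −Q) = −3c · Disc`. [folklore] -/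
theorem derivU_two_hessR : f.derivU (2 * (f.c ^ 2 - 3 * f.b * f.d)) (-(f.b * f.c - 9 * f.a * f.d)) = -3 * f.c * f.disc := by
  simp only [derivU, disc_eq]; ring

/-- `f_v(2R, −Q) = −9d · Disc`. [folklore] -/
theorem derivV_two_hessR : f.derivV (2 * (f.c ^ 2 - 3 * f.b * f.d)) (-(f.b * f.c - 9 * f.a * f.d)) = -9 * f.d * f.disc := by
  simp only [derivV, disc_eq]; ring

/-- `f(−b, 3a) = 2ab·P − 3a²·Q`. [folklore] -/
theorem eval_neg_b : f.eval (-f.b) (3 * f.a) = 2 * f.a * f.b * (f.b ^ 2 - 3 * f.a * f.c) - 3 * f.a ^ 2 * (f.b * f.c - 9 * f.a * f.d) := by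
  simp only [eval]; ring

/-- `f_u(−b, 3a) = −3a·P`. [folklore] -/
theorem derivU_neg_b : f.derivU (-f.b) (3 * f.a) = -3 * f.a * (f.b ^ 2 - 3 * f.a * f.c) := by
  simp only [derivU]; ring

/-- `f_v(−b, 3a) = b·P − 3a·Q`. [folklore] -/
theorem derivV_neg_b : f.derivV (-f.b) (3 * f.a) = f.b * (f.b ^ 2 - 3 * f.a * f.c) - 3 * f.a * (f.b * f.c - 9 * f.a * f.d) := by
  simp only [derivV]; ring

/-- `f(3d, −c) = 2cd·R − 3d²·Q`. [folklore] -/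
theorem eval_three_d : f.eval (3 * f.d) (-f.c) = 2 * f.c * f.d * (f.c ^ 2 - 3 * f.b * f.d) - 3 * f.d ^ 2 * (f.b * f.c - 9 * f.a * f.d) := by
  simp only [eval]; ring

/-- `f_u(3d, −c) = c·R − 3d·Q`. [folklore] -/
theorem derivU_three_d : f.derivU (3 * f.d) (-f.c) = f.c * (f.c ^ 2 - 3 * f.b * f.d) - 3 * f.d * (f.b * f.c - 9 * f.a * f.d) := by
  simp only [derivU]; ring

/-- `f_v(3d, −c) = −3d·R`. [folklore] -/
theorem derivV_three_d : f.derivV (3 * f.d) (-f.c) = -3 * f.d * (f.c ^ 2 - 3 * f.b * f.d) := by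
  simp only [derivV]; ring

/-- `f_u` commutes with change of ring. [folklore] -/
theorem derivU_map {S : Type*} [CommRing S] (φ : R →+* S) (u v : R) :
    (f.map φ).derivU (φ u) (φ v) = φ (f.derivU u v) := by
  simp [derivU, map, map_ofNat]

/-- `f_v` commutes with change of ring. [folklore] -/
theorem derivV_map {S : Type*} [CommRing S] (φ : R →+* S) (u v : R) :
    (f.map φ).derivV (φ u) (φ v) = φ (f.derivV u v) := by
  simp [derivV, map, map_ofNat]

end CommRing

/-! ### A singular zero modulo `p ∣ Disc` -/

/-- Exhaustion over `𝔽₂`: a nonzero binary cubic over `𝔽₂` with zero discriminant has a singular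
zero among `(1,0), (0,1), (1,1)`. [folklore] -/
private theorem singular_zmod_two : ∀ a b c d : ZMod 2, ¬ (a = 0 ∧ b = 0 ∧ c = 0 ∧ d = 0) →
    (⟨a, b, c, d⟩ : BinaryCubic (ZMod 2)).disc = 0 →
    ∃ uv ∈ ({(1, 0), (0, 1), (1, 1)} : Finset (ZMod 2 × ZMod 2)),
      (⟨a, b, c, d⟩ : BinaryCubic (ZMod 2)).eval uv.1 uv.2 = 0 ∧
      (⟨a, b, c, d⟩ : BinaryCubic (ZMod 2)).derivU uv.1 uv.2 = 0 ∧
      (⟨a, b, c, d⟩ : BinaryCubic (ZMod 2)).derivV uv.1 uv.2 = 0 := by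
  simp only [disc_eq, eval, derivU, derivV]
  decide

/-- Exhaustion over `𝔽₃`: a nonzero binary cubic over `𝔽₃` with zero discriminant has a singular
zero among `(1,0), (0,1), (1,1), (1,2)`. [folklore] -/
private theorem singular_zmod_three : ∀ a b c d : ZMod 3, ¬ (a = 0 ∧ b = 0 ∧ c = 0 ∧ d = 0) →
    (⟨a, b, c, d⟩ : BinaryCubic (ZMod 3)).disc = 0 →
    ∃ uv ∈ ({(1, 0), (0, 1), (1, 1), (1, 2)} : Finset (ZMod 3 × ZMod 3)),
      (⟨a, b, c, d⟩ : BinaryCubic (ZMod 3)).eval uv.1 uv.2 = 0 ∧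
      (⟨a, b, c, d⟩ : BinaryCubic (ZMod 3)).derivU uv.1 uv.2 = 0 ∧
      (⟨a, b, c, d⟩ : BinaryCubic (ZMod 3)).derivV uv.1 uv.2 = 0 := by
  simp only [disc_eq, eval, derivU, derivV]
  decide

variable {f : BinaryCubic ℤ} {p : ℕ}

/-- Transport from `𝔽_p`: a singular zero of `f mod p` lifts to a point `(r, s) ≢ (0, 0)` with
`p ∣ f(r,s), f_u(r,s), f_v(r,s)`. [folklore] -/
theorem exists_singular_zero_of_zmod [NeZero p] (u v : ZMod p) (huv : ¬ (u = 0 ∧ v = 0))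
    (h1 : (f.map (Int.castRingHom (ZMod p))).eval u v = 0)
    (h2 : (f.map (Int.castRingHom (ZMod p))).derivU u v = 0)
    (h3 : (f.map (Int.castRingHom (ZMod p))).derivV u v = 0) :
    ∃ r s : ℤ, ¬ ((p : ℤ) ∣ r ∧ (p : ℤ) ∣ s) ∧ (p : ℤ) ∣ f.eval r s ∧ (p : ℤ) ∣ f.derivU r s ∧
      (p : ℤ) ∣ f.derivV r s := by
  refine ⟨(u.val : ℤ), (v.val : ℤ), ?_, ?_, ?_, ?_⟩
  · rintro ⟨hu, hv⟩
    rw [← ZMod.intCast_zmod_eq_zero_iff_dvd] at hu hv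
    push_cast [ZMod.natCast_val, ZMod.cast_id] at hu hv
    exact huv ⟨hu, hv⟩
  · rw [← ZMod.intCast_zmod_eq_zero_iff_dvd, ← eq_intCast (Int.castRingHom (ZMod p)), ← eval_map]
    simpa [ZMod.natCast_val] using h1
  · rw [← ZMod.intCast_zmod_eq_zero_iff_dvd, ← eq_intCast (Int.castRingHom (ZMod p)), ← derivU_map]
    simpa [ZMod.natCast_val] using h2
  · rw [← ZMod.intCast_zmod_eq_zero_iff_dvd, ← eq_intCast (Int.castRingHom (ZMod p)), ← derivV_map]
    simpa [ZMod.natCast_val] using h3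

/-- **A singular zero modulo `p`.** If `p` is prime, `p ∤ f` and `p ∣ Disc f`, then there is a point
`(r, s) ≢ (0, 0) (mod p)` with `p ∣ f(r, s)`, `p ∣ f_u(r, s)`, `p ∣ f_v(r, s)` — the multiple root of
`f (mod p)`: the root `(−Q : 2P)` (or `(2R : −Q)`) of the Hessian when the Hessian is nonzero mod `p`,
the triple root `(−b : 3a)` (or `(3d : −c)`) otherwise; for `p = 2, 3` by exhaustion. [folklore] -/
theorem exists_singular_zero_mod (hp : p.Prime) (hf : ¬ f.IsMultiple p) (hD : (p : ℤ) ∣ f.disc) :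
    ∃ r s : ℤ, ¬ ((p : ℤ) ∣ r ∧ (p : ℤ) ∣ s) ∧ (p : ℤ) ∣ f.eval r s ∧ (p : ℤ) ∣ f.derivU r s ∧
      (p : ℤ) ∣ f.derivV r s := by
  have hp' : Prime (p : ℤ) := Nat.prime_iff_prime_int.mp hp
  haveI : NeZero p := ⟨hp.ne_zero⟩
  -- the reduction mod `p`
  have hF : ¬ ((f.map (Int.castRingHom (ZMod p))).a = 0 ∧ (f.map (Int.castRingHom (ZMod p))).b = 0 ∧
      (f.map (Int.castRingHom (ZMod p))).c = 0 ∧ (f.map (Int.castRingHom (ZMod p))).d = 0) := by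
    simp only [map_a, map_b, map_c, map_d, eq_intCast, ZMod.intCast_zmod_eq_zero_iff_dvd]
    exact hf
  have hFD : (f.map (Int.castRingHom (ZMod p))).disc = 0 := by
    rw [disc_map, eq_intCast, ZMod.intCast_zmod_eq_zero_iff_dvd]; exact hD
  by_cases h2 : p = 2
  · subst h2
    obtain ⟨uv, huv, h1, h2, h3⟩ := singular_zmod_two _ _ _ _ hF hFD
    refine exists_singular_zero_of_zmod uv.1 uv.2 ?_ h1 h2 h3
    simp only [Finset.mem_insert, Finset.mem_singleton] at huv
    rcases huv with rfl | rfl | rfl <;> decide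
  by_cases h3 : p = 3
  · subst h3
    obtain ⟨uv, huv, h1, h2, h3⟩ := singular_zmod_three _ _ _ _ hF hFD
    refine exists_singular_zero_of_zmod uv.1 uv.2 ?_ h1 h2 h3
    simp only [Finset.mem_insert, Finset.mem_singleton] at huv
    rcases huv with rfl | rfl | rfl | rfl <;> decide
  -- `p ≥ 5`
  have hp5 : 5 ≤ p := hp.five_le_of_ne_two_of_ne_three h2 h3
  have hnd2 : ¬ (p : ℤ) ∣ 2 := fun h => by
    have := Int.le_of_dvd (by norm_num) h; omega
  have hnd3 : ¬ (p : ℤ) ∣ 3 := fun h => by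
    have := Int.le_of_dvd (by norm_num) h; omega
  by_cases hP : (p : ℤ) ∣ (f.b ^ 2 - 3 * f.a * f.c)
  · by_cases hR : (p : ℤ) ∣ (f.c ^ 2 - 3 * f.b * f.d)
    · -- the Hessian vanishes mod `p`: a triple root
      have hQ : (p : ℤ) ∣ (f.b * f.c - 9 * f.a * f.d) := by
        refine hp'.dvd_of_dvd_pow (n := 2) ?_
        have : (f.b * f.c - 9 * f.a * f.d) ^ 2 = 4 * (f.b ^ 2 - 3 * f.a * f.c) * (f.c ^ 2 - 3 * f.b * f.d) + (-3) * f.disc := by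
          linear_combination hessQ_sq_sub f
        rw [this]
        exact dvd_add (dvd_mul_of_dvd_left (dvd_mul_of_dvd_right hP 4) _) (dvd_mul_of_dvd_right hD _)
      by_cases ha : (p : ℤ) ∣ f.a
      · by_cases hd : (p : ℤ) ∣ f.d
        · -- then `p ∣ b` and `p ∣ c`: `f ≡ 0`
          exfalso
          have hb : (p : ℤ) ∣ f.b := by
            refine hp'.dvd_of_dvd_pow (n := 2) ?_
            have : f.b ^ 2 = (f.b ^ 2 - 3 * f.a * f.c) + 3 * f.a * f.c := by ring
            rw [this]; exact dvd_add hP (dvd_mul_of_dvd_left (dvd_mul_of_dvd_right ha 3) _)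
          have hc : (p : ℤ) ∣ f.c := by
            refine hp'.dvd_of_dvd_pow (n := 2) ?_
            have : f.c ^ 2 = (f.c ^ 2 - 3 * f.b * f.d) + 3 * f.b * f.d := by ring
            rw [this]; exact dvd_add hR (dvd_mul_of_dvd_right hd _)
          exact hf ⟨ha, hb, hc, hd⟩
        · refine ⟨3 * f.d, -f.c, fun ⟨h, _⟩ => ?_, ?_, ?_, ?_⟩
          · rcases hp'.dvd_or_dvd h with h | h
            · exact hnd3 h
            · exact hd h
          · rw [eval_three_d]
            exact dvd_sub (dvd_mul_of_dvd_right hR _) (dvd_mul_of_dvd_right hQ _)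
          · rw [derivU_three_d]
            exact dvd_sub (dvd_mul_of_dvd_right hR _) (dvd_mul_of_dvd_right hQ _)
          · rw [derivV_three_d]
            exact dvd_mul_of_dvd_right hR _
      · refine ⟨-f.b, 3 * f.a, fun ⟨_, h⟩ => ?_, ?_, ?_, ?_⟩
        · rcases hp'.dvd_or_dvd h with h | h
          · exact hnd3 h
          · exact ha h
        · rw [eval_neg_b]
          exact dvd_sub (dvd_mul_of_dvd_right hP _) (dvd_mul_of_dvd_right hQ _)
        · rw [derivU_neg_b]
          exact dvd_mul_of_dvd_right hP _
        · rw [derivV_neg_b]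
          exact dvd_sub (dvd_mul_of_dvd_right hP _) (dvd_mul_of_dvd_right hQ _)
    · -- `p ∤ R`: the root `(2R : −Q)` of the Hessian
      refine ⟨2 * (f.c ^ 2 - 3 * f.b * f.d), -(f.b * f.c - 9 * f.a * f.d), fun ⟨h, _⟩ => ?_, ?_, ?_, ?_⟩
      · rcases hp'.dvd_or_dvd h with h | h
        · exact hnd2 h
        · exact hR h
      · rw [eval_two_hessR]; exact dvd_mul_of_dvd_right hD _
      · rw [derivU_two_hessR]; exact dvd_mul_of_dvd_right hD _
      · rw [derivV_two_hessR]; exact dvd_mul_of_dvd_right hD _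
  · -- `p ∤ P`: the root `(−Q : 2P)` of the Hessian
    refine ⟨-(f.b * f.c - 9 * f.a * f.d), 2 * (f.b ^ 2 - 3 * f.a * f.c), fun ⟨_, h⟩ => ?_, ?_, ?_, ?_⟩
    · rcases hp'.dvd_or_dvd h with h | h
      · exact hnd2 h
      · exact hP h
    · rw [eval_neg_hessQ]; exact dvd_mul_of_dvd_right hD _
    · rw [derivU_neg_hessQ]; exact dvd_mul_of_dvd_right hD _
    · rw [derivV_neg_hessQ]; exact dvd_mul_of_dvd_right hD _

/-- Lifting a point `≢ (0,0) (mod p)` to a primitive (coprime) point in the same class. [folklore] -/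
theorem exists_isCoprime_congr (hp : p.Prime) {r₀ s₀ : ℤ} (h : ¬ ((p : ℤ) ∣ r₀ ∧ (p : ℤ) ∣ s₀)) :
    ∃ r s : ℤ, IsCoprime r s ∧ (p : ℤ) ∣ r - r₀ ∧ (p : ℤ) ∣ s - s₀ := by
  have hp' : Prime (p : ℤ) := Nat.prime_iff_prime_int.mp hp
  -- if `p ∤ t` then some `r ≡ r₀` is coprime to `t`
  have key : ∀ r₀ t : ℤ, ¬ (p : ℤ) ∣ t → ∃ r : ℤ, IsCoprime r t ∧ (p : ℤ) ∣ r - r₀ := by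
    intro r₀ t ht
    obtain ⟨m, n, hmn⟩ := (Irreducible.coprime_iff_not_dvd hp'.irreducible).mpr ht
    refine ⟨r₀ + (1 - r₀) * m * p, ⟨1, n * (1 - r₀), by linear_combination (1 - r₀) * hmn⟩,
      ⟨(1 - r₀) * m, by ring⟩⟩
  by_cases hs : (p : ℤ) ∣ s₀
  · have hr : ¬ (p : ℤ) ∣ r₀ := fun hr => h ⟨hr, hs⟩
    obtain ⟨s, hcop, hs'⟩ := key s₀ r₀ hr
    exact ⟨r₀, s, hcop.symm, by simp, hs'⟩
  · obtain ⟨r, hcop, hr'⟩ := key r₀ s₀ hs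
    exact ⟨r, s₀, hcop, hr', by simp⟩

/-- Values of `f`, `f_u`, `f_v` only depend on the point modulo `p`. [folklore] -/
theorem dvd_eval_of_dvd_sub {r s r₀ s₀ : ℤ} (hr : (p : ℤ) ∣ r - r₀) (hs : (p : ℤ) ∣ s - s₀) :
    ((p : ℤ) ∣ f.eval r₀ s₀ → (p : ℤ) ∣ f.eval r s) ∧ ((p : ℤ) ∣ f.derivU r₀ s₀ → (p : ℤ) ∣ f.derivU r s) ∧
      ((p : ℤ) ∣ f.derivV r₀ s₀ → (p : ℤ) ∣ f.derivV r s) := by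
  have hr' : ((r : ℤ) : ZMod p) = r₀ :=
    ((ZMod.intCast_eq_intCast_iff_dvd_sub r₀ r p).mpr hr).symm
  have hs' : ((s : ℤ) : ZMod p) = s₀ :=
    ((ZMod.intCast_eq_intCast_iff_dvd_sub s₀ s p).mpr hs).symm
  simp only [← ZMod.intCast_zmod_eq_zero_iff_dvd, ← eq_intCast (Int.castRingHom (ZMod p)), ← eval_map,
    ← derivU_map, ← derivV_map]
  simp only [eq_intCast, hr', hs']
  exact ⟨id, id, id⟩

/-- **The multiple root moved to `(1 : 0)`.** If `p` is prime, `p ∤ f` and `p ∣ Disc f`, then some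
`GL₂(ℤ)`-translate `g` of `f` has `p ∣ a(g)` and `p ∣ b(g)`. [folklore] -/
theorem exists_gl2zEquiv_dvd_a_dvd_b (hp : p.Prime) (hf : ¬ f.IsMultiple p) (hD : (p : ℤ) ∣ f.disc) :
    ∃ g : BinaryCubic ℤ, GL2ZEquiv f g ∧ (p : ℤ) ∣ g.a ∧ (p : ℤ) ∣ g.b := by
  obtain ⟨r₀, s₀, hnd, h1, h2, h3⟩ := exists_singular_zero_mod hp hf hD
  obtain ⟨r, s, hcop, hr, hs⟩ := exists_isCoprime_congr hp hnd
  obtain ⟨e1, e2, e3⟩ := dvd_eval_of_dvd_sub (f := f) hr hs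
  obtain ⟨u, v, huv⟩ := hcop
  let γ : Matrix (Fin 2) (Fin 2) ℤ := !![r, s; -v, u]
  have hdet : γ.det = 1 := by
    rw [Matrix.det_fin_two_of]; linear_combination huv
  refine ⟨twist γ f, ⟨γ, by rw [hdet]; exact isUnit_one, rfl⟩, ?_, ?_⟩
  · rw [twist, hdet, one_smul, subst_a_eq_eval]
    simpa [γ] using e1 h1
  · rw [twist, hdet, one_smul, subst_b_eq_deriv]
    simp only [γ, Matrix.of_apply, Matrix.cons_val', Matrix.cons_val_zero, Matrix.cons_val_one,
      Matrix.cons_val_fin_one, Matrix.empty_val']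
    exact dvd_add (dvd_mul_of_dvd_right (e2 h2) _) (dvd_mul_of_dvd_right (e3 h3) _)

end BinaryCubic

end Literature.NumberTheory.CubicFields
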